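import Summits.AtomisticToContinuum.Crystallization.Theorems.FrustratedLawDichotomyStrainedPatchHomSlabLeaf

/-!
# SECOND-ORDER RADIAL EXTERIOR, real side: slope growth under an `s`-DEPENDENT curvature floor, the Taylor-rate exterior force bound, and the
# slab / exempt dichotomy from a TARGET-FORCE hypothesis (27623 `(H) HomFloor`, hcp half; hand-1 g39, RING-LEAF-SPEC §6 item E1; critic rows 1467 (D5) / 1469 (A2)–(A4))

decomp-a2c hand-1 g39 (crux `AperiodicFrustratedLawGap`, stmt-AtomisticToContinuum-27623).  WHY.  The analytic slab leaf certifies «exempt» outside its slab by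
RADIAL GROWTH with a CONSTANT curvature floor `q = λ_T‖Δ‖²` (`…HomForceRing.hcpForce_growth`, `…HomExemptZeroStep.slab_or_exempt_of_ring`,
`…HomSlabLeaf.hver_of_slabParts`), where `λ_T` charges the box remainders `W` (first order in the displacement) and `rem` (second order) IN FULL — so the floor, and
with it the leaf, dies at ξ-radius `≈ 1.5·10⁻²` (hand-1 g39 FINDING/RING-LEAF-SPEC: `rem ≈ 0.9·R²`, `W ≈ 1.9 + 0.08 R`, `R` in `10⁻²`/`10⁻³`).  Charged at their
TAYLOR RATE along the ray — floor `(λ − a·s − b·s²)‖Δ‖²` at parameter `s` — the integrated growth is `(λ − a/2 − b/3)‖Δ‖²`, and ONE certificate on a `±2·10⁻²`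
box certifies the whole exterior shell of a production `U`-column (native gate G1′: margins `+0.0045 … +0.07` over `S₇♯` along the worst ray, `t`-independent).
This file is the def-free real side of that certificate (the kernel Boolean + its soundness, `curvLJ_floorMTaylor_of_check`, is the successor's item E2):

* §1 ★ `slope_growth_of_curvature_fn` — `…HomConvexSegment.slope_growth_of_curvature_sum` with an `s`-dependent floor `κ s` and any antiderivative `K`
  (`K 0 = 0`, `K′ = κ`): `Σ segG … 0 + K s ≤ Σ segG … s` on `[0, 1]` (same proof: `Σ segG − K` has derivative `≥ 0` off the finite exceptional set);
* §2 ★ `hcpForce_growth_fn` (hcp shifted family, any regular force profile) and ★★ `hcpForceLJ_exterior_taylor` — floor `(λ − a s − b s²)‖Δ‖²` ⟹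
  `((λ − a/2 − b/3)‖Δ‖ − f₀)‖Δ‖ ≤ Σ_b (‖X_b‖⁻⁸ − ‖X_b‖⁻¹⁴)⟪X_b, Δ⟫` at the target, kernel form;
* §3 ★★ `slab_or_exempt_of_targetForce` / ★★★ `hver_of_slabParts_of_targetForce` — the dichotomy and the `hver`-shaped leaf conclusion from the TARGET-FORCE
  inequality itself (`(q/‖Δ‖ − f₀)‖Δ‖ ≤ Σ …`, however obtained), so every future growth law plugs in without touching `…HomExemptZeroStep`;
* §4 ★★★ `slab_or_exempt_of_taylorRing` / `hver_of_slabParts_taylor` — the Taylor-rate instances (`q := (λ − a/2 − b/3)‖U(ξ − ξ₀)‖²`).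

NO definitions; 0 sorry; standard axioms; no instances / notation / `#eval`.  `--supports stmt-AtomisticToContinuum-27623`.
-/

noncomputable section

namespace Summit.AtomisticToContinuum.Crystallization.Theorems.FrustratedLawDichotomyStrainedPatchHomExteriorTaylor

open scoped BigOperators RealInnerProductSpace
open Literature.Analysis.ValidatedNumerics.Numerics
open Summit.AtomisticToContinuum.Crystallization.Theorems.ChargedEnergyGapNegative (E3)
open Summit.AtomisticToContinuum.Crystallization.Theorems.FrustratedLawDichotomySchurCut (effPot w₄₅ ω₄)
open Summit.AtomisticToContinuum.Crystallization.Theorems.FrustratedLawDichotomyAveragingRuleTightFree (TightNearCap BadNearCap)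
open Summit.AtomisticToContinuum.Crystallization.Theorems.FrustratedLawDichotomyExemptAbsorption (ExemptNear)
open Summit.AtomisticToContinuum.Crystallization.Theorems.FrustratedLawDichotomyStrainedPatchHomSplit (ExRec latPt hexFrame hcpShift)
open Summit.AtomisticToContinuum.Crystallization.Theorems.FrustratedLawDichotomyStrainedPatchTaylorChord
  (segR segN segS segG segGd segN_eq_inner segExc mem_segExc)
open Summit.AtomisticToContinuum.Crystallization.Theorems.FrustratedLawDichotomyStrainedPatchHomConvexSegment
  (monotoneOn_of_deriv_nonneg_off hasDerivAt_segG' continuousOn_segG norm_shuffle_segment_le)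
open Summit.AtomisticToContinuum.Crystallization.Theorems.FrustratedLawDichotomyStrainedPatchHomLatticeBoxHcp (norm_shifted_gt)
open Summit.AtomisticToContinuum.Crystallization.Theorems.FrustratedLawDichotomyStrainedPatchHomForceRing
  (segG_of_zero continuousOn_ljProfile hasDerivAt_ljProfile segG_ljProfile_one segG_ljProfile_zero)
open Summit.AtomisticToContinuum.Crystallization.Theorems.FrustratedLawDichotomyStrainedPatchHomExemptZeroStep
  (exemptNear_of_forceB_gt forceRest_ge segGd_of_zero)

/-! ## §1. Slope growth under an `s`-dependent curvature floor -/

/-- ★ **SLOPE GROWTH FROM AN `s`-DEPENDENT CURVATURE-SUM FLOOR** (generalises `…HomConvexSegment.slope_growth_of_curvature_sum`, whose floor is constant):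
tube `a ≤ ‖p_i + sΔ‖ ≤ b` (`a > 0`) on `[0,1]`, `W₁` continuous on `[a, b]` and differentiable on `(a, b) ∖ J` (`J` finite); at every good parameter the curvature
sum is `≥ κ s`; `K` an antiderivative of `κ` with `K 0 = 0`.  THEN `Σ_i segG … 0 + K s ≤ Σ_i segG … s` on `[0, 1]`.
[folklore: `Σ segG − K` has derivative `Σ segGd − κ ≥ 0` off `⋃_i segExc`] -/
theorem slope_growth_of_curvature_fn {ι : Type*} (S : Finset ι) (p : ι → EuclideanSpace ℝ (Fin 3)) {Δ : EuclideanSpace ℝ (Fin 3)} (hΔ : Δ ≠ 0)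
    {W₁ : ℝ → ℝ} (J : Finset ℝ) {a b : ℝ} {κ K : ℝ → ℝ} (ha : 0 < a) (hcont : ContinuousOn W₁ (Set.Icc a b))
    (hdiff : ∀ r, a < r → r < b → r ∉ J → HasDerivAt W₁ (deriv W₁ r) r)
    (htube : ∀ i ∈ S, ∀ s ∈ Set.Icc (0 : ℝ) 1, a ≤ ‖p i + s • Δ‖ ∧ ‖p i + s • Δ‖ ≤ b)
    (hK0 : K 0 = 0) (hK : ∀ s, HasDerivAt K (κ s) s)
    (hcurv : ∀ s ∈ Set.Ioo (0 : ℝ) 1, (∀ i ∈ S, a < segR (p i) Δ s ∧ segR (p i) Δ s < b ∧ segR (p i) Δ s ∉ J) →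
      κ s ≤ ∑ i ∈ S, segGd W₁ (p i) Δ s) :
    ∀ s ∈ Set.Icc (0 : ℝ) 1, ∑ i ∈ S, segG W₁ (p i) Δ 0 + K s ≤ ∑ i ∈ S, segG W₁ (p i) Δ s := by
  classical
  set h : ℝ → ℝ := fun s => ∑ i ∈ S, segG W₁ (p i) Δ s - K s with hh
  set X : Finset ℝ := S.biUnion (fun i => segExc (p i) Δ (insert a (insert b J))) with hX
  -- good parameters: every radius avoids `{a, b} ∪ J`
  have good : ∀ s ∈ Set.Ioo (0 : ℝ) 1, s ∉ X → ∀ i ∈ S, a < segR (p i) Δ s ∧ segR (p i) Δ s < b ∧ segR (p i) Δ s ∉ J := by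
    intro s hs hsX i hi
    have hnot : segR (p i) Δ s ∉ insert a (insert b J) := fun hmem =>
      hsX (Finset.mem_biUnion.2 ⟨i, hi, mem_segExc hΔ hmem⟩)
    simp only [Finset.mem_insert, not_or] at hnot
    obtain ⟨hna, hnb, hnJ⟩ := hnot
    have ht := htube i hi s (Set.Ioo_subset_Icc_self hs)
    exact ⟨lt_of_le_of_ne ht.1 (Ne.symm hna), lt_of_le_of_ne ht.2 hnb, hnJ⟩
  have hKc : Continuous K := continuous_iff_continuousAt.2 fun s => (hK s).continuousAt
  have hcontH : ContinuousOn h (Set.Icc 0 1) := by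
    have h1 : ContinuousOn (fun s => ∑ i ∈ S, segG W₁ (p i) Δ s) (Set.Icc 0 1) :=
      continuousOn_finsetSum S fun i hi => continuousOn_segG hcont ha (htube i hi)
    exact h1.sub hKc.continuousOn
  have hderH : ∀ s ∈ Set.Ioo (0 : ℝ) 1, s ∉ X → HasDerivAt h (∑ i ∈ S, segGd W₁ (p i) Δ s - κ s) s := by
    intro s hs hsX
    have hg := good s hs hsX
    have hsum : HasDerivAt (fun t => ∑ i ∈ S, segG W₁ (p i) Δ t) (∑ i ∈ S, segGd W₁ (p i) Δ s) s := by
      refine HasDerivAt.fun_sum fun i hi => ?_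
      obtain ⟨h1, h2, h3⟩ := hg i hi
      exact hasDerivAt_segG' (ha.trans h1).ne' (hdiff _ h1 h2 h3)
    exact hsum.sub (hK s)
  have hnn : ∀ s ∈ Set.Ioo (0 : ℝ) 1, s ∉ X → 0 ≤ ∑ i ∈ S, segGd W₁ (p i) Δ s - κ s :=
    fun s hs hsX => sub_nonneg.2 (hcurv s hs (good s hs hsX))
  intro s hs
  have hmono := monotoneOn_of_deriv_nonneg_off X hcontH hderH hnn 0 s le_rfl hs.2 hs.1
  simp only [hh, hK0, sub_zero] at hmono
  linarith

/-! ## §2. The hcp shifted family: growth under an `s`-dependent floor, and the Taylor-rate exterior force bound -/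

/-- ★ **RADIAL GROWTH OF THE hcp `B`-FAMILY FORCE UNDER AN `s`-DEPENDENT FLOOR** (twin of `…HomForceRing.hcpForce_growth`): `‖U − 1‖ ≤ 1/4`,
`‖ξ₀‖, ‖ξ‖ ≤ 1/4`, any label finset `B`, `W₁` regular on `r ≥ 3/8`, floor `κ s ≤ Σ_b segGd W₁ p_b Δ s` (`p_b = latPt U hexFrame b + U(hcpShift + ξ₀)`,
`Δ = U(ξ − ξ₀)`), `K` an antiderivative of `κ` with `K 0 = 0` ⟹ `Σ_b segG … 0 + K 1 ≤ Σ_b segG … 1`. [folklore chaining] -/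
theorem hcpForce_growth_fn (B : Finset (Fin 3 → ℤ)) {U : E3 →L[ℝ] E3} (hU : ‖U - 1‖ ≤ 1 / 4) {ξ₀ ξ : E3} (hξ₀ : ‖ξ₀‖ ≤ 1 / 4) (hξ : ‖ξ‖ ≤ 1 / 4)
    {W₁ : ℝ → ℝ} (hcont : ContinuousOn W₁ (Set.Ici (3 / 8))) (hdiff : ∀ r, (3 : ℝ) / 8 < r → HasDerivAt W₁ (deriv W₁ r) r) {κ K : ℝ → ℝ}
    (hK0 : K 0 = 0) (hK : ∀ s, HasDerivAt K (κ s) s) (hκ0 : U (ξ - ξ₀) = 0 → K 1 ≤ 0)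
    (hcurv : ∀ s ∈ Set.Ioo (0 : ℝ) 1,
      κ s ≤ ∑ bb ∈ B, segGd W₁ (latPt U hexFrame bb + U (hcpShift + ξ₀)) (U (ξ - ξ₀)) s) :
    ∑ bb ∈ B, segG W₁ (latPt U hexFrame bb + U (hcpShift + ξ₀)) (U (ξ - ξ₀)) 0 + K 1 ≤
      ∑ bb ∈ B, segG W₁ (latPt U hexFrame bb + U (hcpShift + ξ₀)) (U (ξ - ξ₀)) 1 := by
  by_cases hΔ : U (ξ - ξ₀) = 0
  · -- degenerate direction: both slope sums vanish; `K 1 ≤ 0`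
    have hK1 := hκ0 hΔ
    simp [hΔ, segG_of_zero]
    exact hK1
  set p : (Fin 3 → ℤ) → E3 := fun bb => latPt U hexFrame bb + U (hcpShift + ξ₀) with hp
  set Δ : E3 := U (ξ - ξ₀) with hΔdef
  set bhi : ℝ := (∑ bb ∈ B, ‖p bb‖) + ‖Δ‖ + 1 with hbhi
  have hseg : ∀ bb : Fin 3 → ℤ, ∀ s : ℝ, p bb + s • Δ = latPt U hexFrame bb + U (hcpShift + (ξ₀ + s • (ξ - ξ₀))) := by
    intro bb s
    simp only [hp, hΔdef, map_add, map_smul]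
    abel
  have htube : ∀ bb ∈ B, ∀ s ∈ Set.Icc (0 : ℝ) 1, 3 / 8 ≤ ‖p bb + s • Δ‖ ∧ ‖p bb + s • Δ‖ ≤ bhi := by
    intro bb hbb s hs
    constructor
    · rw [hseg]
      exact (norm_shifted_gt hU (norm_shuffle_segment_le hξ₀ hξ hs) bb).le
    · have h1 : ‖p bb + s • Δ‖ ≤ ‖p bb‖ + ‖Δ‖ := by
        calc ‖p bb + s • Δ‖ ≤ ‖p bb‖ + ‖s • Δ‖ := norm_add_le _ _
          _ ≤ ‖p bb‖ + ‖Δ‖ := by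
              rw [norm_smul, Real.norm_eq_abs, abs_of_nonneg hs.1]
              nlinarith [norm_nonneg Δ, hs.2]
      have h2 : ‖p bb‖ ≤ ∑ bb ∈ B, ‖p bb‖ := Finset.single_le_sum (fun _ _ => norm_nonneg _) hbb
      rw [hbhi]; linarith
  have ha : (0 : ℝ) < 3 / 8 := by norm_num
  have hcont' : ContinuousOn W₁ (Set.Icc (3 / 8) bhi) := hcont.mono fun r hr => hr.1
  have hdiff' : ∀ r, (3 : ℝ) / 8 < r → r < bhi → r ∉ (∅ : Finset ℝ) → HasDerivAt W₁ (deriv W₁ r) r := fun r hr _ _ => hdiff r hr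
  have hcurv' : ∀ s ∈ Set.Ioo (0 : ℝ) 1, (∀ bb ∈ B, 3 / 8 < segR (p bb) Δ s ∧ segR (p bb) Δ s < bhi ∧ segR (p bb) Δ s ∉ (∅ : Finset ℝ)) →
      κ s ≤ ∑ bb ∈ B, segGd W₁ (p bb) Δ s := fun s hs _ => hcurv s hs
  exact slope_growth_of_curvature_fn B p hΔ ∅ ha hcont' hdiff' htube hK0 hK hcurv' 1 ⟨zero_le_one, le_rfl⟩

/-- The Taylor antiderivative: `K s = (λ s − a s²/2 − b s³/3)·‖Δ‖²` has derivative `(λ − a s − b s²)·‖Δ‖²`. [calculus] -/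
theorem hasDerivAt_taylorFloor (lam a b n s : ℝ) :
    HasDerivAt (fun t : ℝ => (lam * t - a * t ^ 2 / 2 - b * t ^ 3 / 3) * n) ((lam - a * s - b * s ^ 2) * n) s := by
  have h1 : HasDerivAt (fun t : ℝ => lam * t - a * t ^ 2 / 2 - b * t ^ 3 / 3) (lam - a * s - b * s ^ 2) s := by
    have hid := hasDerivAt_id s
    have hl : HasDerivAt (fun t : ℝ => lam * t) (lam * 1) s := hid.const_mul lam
    have hq : HasDerivAt (fun t : ℝ => a * t ^ 2 / 2) (a * ((2 : ℕ) * s ^ (2 - 1) * 1) / 2) s := ((hid.pow 2).const_mul a).div_const 2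
    have hc : HasDerivAt (fun t : ℝ => b * t ^ 3 / 3) (b * ((3 : ℕ) * s ^ (3 - 1) * 1) / 3) s := ((hid.pow 3).const_mul b).div_const 3
    refine ((hl.sub hq).sub hc).congr_deriv ?_
    push_cast
    ring_nf
  simpa using h1.mul_const n

/-- ★★ **TAYLOR-RATE EXTERIOR FORCE BOUND, LENNARD-JONES `B`-FAMILY, KERNEL FORM.**  For `‖U − 1‖ ≤ 1/4`, `‖ξ₀‖, ‖ξ‖ ≤ 1/4`, any label finset `B`,
an `s`-dependent force-Jacobian floor `(λ − a s − b s²)‖Δ‖² ≤ Σ_b segGd …` of the LJ profile along `Δ = U(ξ − ξ₀)` (`λ` the centre floor, `a`, `b` the first-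
and second-order box remainders scaled to the actual displacement) and a reference bound `f₀`:
`((λ − a/2 − b/3)‖Δ‖ − f₀)‖Δ‖ ≤ Σ_b (‖X_b‖⁻⁸ − ‖X_b‖⁻¹⁴)⟪X_b, Δ⟫`, `X_b = latPt U hexFrame b + U(hcpShift + ξ)`. [folklore chaining] -/
theorem hcpForceLJ_exterior_taylor (B : Finset (Fin 3 → ℤ)) {U : E3 →L[ℝ] E3} (hU : ‖U - 1‖ ≤ 1 / 4) {ξ₀ ξ : E3} (hξ₀ : ‖ξ₀‖ ≤ 1 / 4)
    (hξ : ‖ξ‖ ≤ 1 / 4) {lam a b f₀ : ℝ}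
    (hcurv : ∀ s ∈ Set.Ioo (0 : ℝ) 1, (lam - a * s - b * s ^ 2) * ‖U (ξ - ξ₀)‖ ^ 2 ≤
      ∑ bb ∈ B, segGd (fun x : ℝ => x⁻¹ ^ 7 - x⁻¹ ^ 13) (latPt U hexFrame bb + U (hcpShift + ξ₀)) (U (ξ - ξ₀)) s)
    (hf₀ : |∑ bb ∈ B, (‖latPt U hexFrame bb + U (hcpShift + ξ₀)‖⁻¹ ^ 8 - ‖latPt U hexFrame bb + U (hcpShift + ξ₀)‖⁻¹ ^ 14) *
        ⟪latPt U hexFrame bb + U (hcpShift + ξ₀), U (ξ - ξ₀)⟫| ≤ f₀ * ‖U (ξ - ξ₀)‖) :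
    ((lam - a / 2 - b / 3) * ‖U (ξ - ξ₀)‖ - f₀) * ‖U (ξ - ξ₀)‖ ≤
      ∑ bb ∈ B, (‖latPt U hexFrame bb + U (hcpShift + ξ)‖⁻¹ ^ 8 - ‖latPt U hexFrame bb + U (hcpShift + ξ)‖⁻¹ ^ 14) *
        ⟪latPt U hexFrame bb + U (hcpShift + ξ), U (ξ - ξ₀)⟫ := by
  have hpt : ∀ bb : Fin 3 → ℤ, latPt U hexFrame bb + U (hcpShift + ξ₀) + U (ξ - ξ₀) = latPt U hexFrame bb + U (hcpShift + ξ) := by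
    intro bb
    rw [add_assoc, ← map_add]
    congr 2
    abel
  have e0 : ∑ bb ∈ B, segG (fun x : ℝ => x⁻¹ ^ 7 - x⁻¹ ^ 13) (latPt U hexFrame bb + U (hcpShift + ξ₀)) (U (ξ - ξ₀)) 0 =
      ∑ bb ∈ B, (‖latPt U hexFrame bb + U (hcpShift + ξ₀)‖⁻¹ ^ 8 - ‖latPt U hexFrame bb + U (hcpShift + ξ₀)‖⁻¹ ^ 14) *
        ⟪latPt U hexFrame bb + U (hcpShift + ξ₀), U (ξ - ξ₀)⟫ :=
    Finset.sum_congr rfl fun bb _ => segG_ljProfile_zero _ _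
  have e1 : ∑ bb ∈ B, segG (fun x : ℝ => x⁻¹ ^ 7 - x⁻¹ ^ 13) (latPt U hexFrame bb + U (hcpShift + ξ₀)) (U (ξ - ξ₀)) 1 =
      ∑ bb ∈ B, (‖latPt U hexFrame bb + U (hcpShift + ξ)‖⁻¹ ^ 8 - ‖latPt U hexFrame bb + U (hcpShift + ξ)‖⁻¹ ^ 14) *
        ⟪latPt U hexFrame bb + U (hcpShift + ξ), U (ξ - ξ₀)⟫ := by
    refine Finset.sum_congr rfl fun bb _ => ?_
    rw [segG_ljProfile_one, hpt]
  -- growth with the Taylor antiderivative `K s = (λ s − a s²/2 − b s³/3)‖Δ‖²`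
  have hK := fun s => hasDerivAt_taylorFloor lam a b (‖U (ξ - ξ₀)‖ ^ 2) s
  have hgrow := hcpForce_growth_fn B hU hξ₀ hξ continuousOn_ljProfile (fun r hr => hasDerivAt_ljProfile (lt_trans (by norm_num) hr).ne')
    (κ := fun s => (lam - a * s - b * s ^ 2) * ‖U (ξ - ξ₀)‖ ^ 2) (K := fun t => (lam * t - a * t ^ 2 / 2 - b * t ^ 3 / 3) * ‖U (ξ - ξ₀)‖ ^ 2)
    (by simp) hK (fun h0 => by rw [h0, norm_zero]; simp) hcurv
  rw [e0, e1] at hgrow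
  have h0 := (abs_le.1 hf₀).1
  have hK1 : (lam * 1 - a * 1 ^ 2 / 2 - b * 1 ^ 3 / 3) * ‖U (ξ - ξ₀)‖ ^ 2 = (lam - a / 2 - b / 3) * ‖U (ξ - ξ₀)‖ ^ 2 := by ring
  rw [hK1] at hgrow
  nlinarith [hgrow, h0]

/-! ## §3. The slab / exempt dichotomy from a TARGET-FORCE hypothesis -/

/-- ★★ **SLAB OR EXEMPT FROM THE TARGET FORCE** (twin of `…HomExemptZeroStep.slab_or_exempt_of_ring` with the growth law abstracted away): the homogeneous hcp
`133/10`-ball with data `(U, ξ)`, the label split `B ∪ R` of the in-ball shifted family, and the TARGET-FORCE inequality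
`(q/‖Δ‖ − f₀)·‖Δ‖ ≤ Σ_{b ∈ B} (‖X_b‖⁻⁸ − ‖X_b‖⁻¹⁴)⟪X_b, Δ⟫` (`Δ = U(ξ − ξ₀)`; plus `q ≤ 0` in the degenerate direction `Δ = 0`).  THEN either
`q ≤ (S₇♯(7) + f₀ + |R|·6⁻⁷)·‖Δ‖` (the shuffle lies in the slab) or `ExemptNear (9/5) ExRec z c`. [folklore chaining: `exemptNear_of_forceB_gt`] -/
theorem slab_or_exempt_of_targetForce {M : ℕ} {z : Fin M → E3} {c : Fin M} (hz : Function.Injective z) {U : E3 →L[ℝ] E3} {ξ₀ ξ : E3}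
    (hU : ‖U - 1‖ ≤ 1 / 4) (hξ : ‖ξ‖ ≤ 1 / 4)
    (hrange : Set.range z = {x : E3 | dist x (z c) ≤ 133 / 10 ∧ ∃ a : Fin 3 → ℤ,
      x = z c + latPt U hexFrame a ∨ x = z c + latPt U hexFrame a + U (hcpShift + ξ)})
    (B R : Finset (Fin 3 → ℤ)) (hB : B ⊆ Fintype.piFinset fun _ : Fin 3 => Finset.Icc (-11 : ℤ) 11)
    (hBin : ∀ bb ∈ B, ‖latPt U hexFrame bb + U (hcpShift + ξ)‖ ≤ 7)
    (hR : ∀ bb ∈ (Fintype.piFinset fun _ : Fin 3 => Finset.Icc (-11 : ℤ) 11) \ B, ‖latPt U hexFrame bb + U (hcpShift + ξ)‖ ≤ 7 →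
      bb ∈ R ∧ 6 ≤ ‖latPt U hexFrame bb + U (hcpShift + ξ)‖)
    {q f₀ : ℝ} (hq0 : U (ξ - ξ₀) = 0 → q ≤ 0)
    (hext : (q / ‖U (ξ - ξ₀)‖ - f₀) * ‖U (ξ - ξ₀)‖ ≤
      ∑ bb ∈ B, (‖latPt U hexFrame bb + U (hcpShift + ξ)‖⁻¹ ^ 8 - ‖latPt U hexFrame bb + U (hcpShift + ξ)‖⁻¹ ^ 14) *
        ⟪latPt U hexFrame bb + U (hcpShift + ξ), U (ξ - ξ₀)⟫) :
    q ≤ ((6000 / 343 * (7 : ℝ)⁻¹ ^ 4 + 2880 / 49 * (7 : ℝ)⁻¹ ^ 5 + 10 / 7 * (7 : ℝ)⁻¹ ^ 6 + 2 * (7 : ℝ)⁻¹ ^ 7) + f₀ + R.card * (6 : ℝ)⁻¹ ^ 7) *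
        ‖U (ξ - ξ₀)‖ ∨ ExemptNear (9 / 5) ExRec z c := by
  classical
  set box := (Fintype.piFinset fun _ : Fin 3 => Finset.Icc (-11 : ℤ) 11) with hbox
  set S7 : ℝ := 6000 / 343 * (7 : ℝ)⁻¹ ^ 4 + 2880 / 49 * (7 : ℝ)⁻¹ ^ 5 + 10 / 7 * (7 : ℝ)⁻¹ ^ 6 + 2 * (7 : ℝ)⁻¹ ^ 7 with hS7
  set X : (Fin 3 → ℤ) → E3 := fun bb => latPt U hexFrame bb + U (hcpShift + ξ) with hX
  by_cases hΔ0 : U (ξ - ξ₀) = 0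
  · left
    rw [hΔ0, norm_zero, mul_zero]
    exact hq0 hΔ0
  rcases le_or_gt q ((S7 + f₀ + R.card * (6 : ℝ)⁻¹ ^ 7) * ‖U (ξ - ξ₀)‖) with hle | hlt
  · exact Or.inl hle
  right
  have hpos : 0 < ‖U (ξ - ξ₀)‖ := norm_pos_iff.2 hΔ0
  have h1 : q / ‖U (ξ - ξ₀)‖ * ‖U (ξ - ξ₀)‖ = q := div_mul_cancel₀ q hpos.ne'
  -- the unit direction of the shuffle displacement
  set e : E3 := ‖U (ξ - ξ₀)‖⁻¹ • U (ξ - ξ₀) with he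
  have hne : ‖e‖ = 1 := by rw [he, norm_smul, norm_inv, norm_norm, inv_mul_cancel₀ hpos.ne']
  refine exemptNear_of_forceB_gt hz hU hξ hrange e hne.le ?_
  have hsplit := Finset.sum_sdiff hB (f := fun bb => if X bb ≠ 0 ∧ ‖X bb‖ ≤ 7 then (‖X bb‖⁻¹ ^ 8 - ‖X bb‖⁻¹ ^ 14) * ⟪X bb, e⟫ else 0)
  -- on `B` the indicator is on and `⟪X, e⟫ = ⟪X, Δ⟫/‖Δ‖`
  have hBsum : ∑ bb ∈ B, (if X bb ≠ 0 ∧ ‖X bb‖ ≤ 7 then (‖X bb‖⁻¹ ^ 8 - ‖X bb‖⁻¹ ^ 14) * ⟪X bb, e⟫ else 0) =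
      ‖U (ξ - ξ₀)‖⁻¹ * ∑ bb ∈ B, (‖X bb‖⁻¹ ^ 8 - ‖X bb‖⁻¹ ^ 14) * ⟪X bb, U (ξ - ξ₀)⟫ := by
    rw [Finset.mul_sum]
    refine Finset.sum_congr rfl fun bb hbb => ?_
    have hX0 : X bb ≠ 0 := norm_pos_iff.1 (lt_trans (by norm_num) (norm_shifted_gt hU hξ bb))
    rw [if_pos ⟨hX0, hBin bb hbb⟩, he, real_inner_smul_right]
    ring
  have hrest := forceRest_ge box B R X hR hne.le
  -- the `B`-part exceeds `S₇♯ + |R|·6⁻⁷`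
  have h2 : S7 + f₀ + R.card * (6 : ℝ)⁻¹ ^ 7 < q / ‖U (ξ - ξ₀)‖ := by
    rw [lt_div_iff₀ hpos]; exact hlt
  have h3 : (S7 + R.card * (6 : ℝ)⁻¹ ^ 7) * ‖U (ξ - ξ₀)‖ <
      ∑ bb ∈ B, (‖X bb‖⁻¹ ^ 8 - ‖X bb‖⁻¹ ^ 14) * ⟪X bb, U (ξ - ξ₀)⟫ := by
    have : (S7 + R.card * (6 : ℝ)⁻¹ ^ 7) * ‖U (ξ - ξ₀)‖ < (q / ‖U (ξ - ξ₀)‖ - f₀) * ‖U (ξ - ξ₀)‖ :=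
      mul_lt_mul_of_pos_right (by linarith) hpos
    exact lt_of_lt_of_le this hext
  have hBgt : S7 + R.card * (6 : ℝ)⁻¹ ^ 7 < ‖U (ξ - ξ₀)‖⁻¹ * ∑ bb ∈ B, (‖X bb‖⁻¹ ^ 8 - ‖X bb‖⁻¹ ^ 14) * ⟪X bb, U (ξ - ξ₀)⟫ := by
    rw [inv_mul_eq_div, lt_div_iff₀ hpos]
    exact h3
  show S7 < ∑ bb ∈ box, (if X bb ≠ 0 ∧ ‖X bb‖ ≤ 7 then (‖X bb‖⁻¹ ^ 8 - ‖X bb‖⁻¹ ^ 14) * ⟪X bb, e⟫ else 0)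
  rw [← hsplit, hBsum]
  linarith [hrest, hBgt]

/-- ★★★ **THE `hver` CONCLUSION OF THE SLAB LEAF FROM A TARGET-FORCE HYPOTHESIS** (twin of `…HomSlabLeaf.hver_of_slabParts`): if, whenever the shuffle lies
in the slab `q ≤ (S₇♯ + f₀ + |R|·6⁻⁷)·‖U(ξ − ξ₀)‖`, the leaf conclusion holds (the fit leaf covers the slab), then it holds — outside the slab the exempt
disjunct serves every enumeration. [folklore chaining] -/
theorem hver_of_slabParts_of_targetForce {μ : ℤ} {U : E3 →L[ℝ] E3} {ξ₀ ξ : E3} (hU : ‖U - 1‖ ≤ 1 / 4) (hξ : ‖ξ‖ ≤ 1 / 4)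
    (B R : Finset (Fin 3 → ℤ)) (hB : B ⊆ Fintype.piFinset fun _ : Fin 3 => Finset.Icc (-11 : ℤ) 11)
    (hBin : ∀ bb ∈ B, ‖latPt U hexFrame bb + U (hcpShift + ξ)‖ ≤ 7)
    (hR : ∀ bb ∈ (Fintype.piFinset fun _ : Fin 3 => Finset.Icc (-11 : ℤ) 11) \ B, ‖latPt U hexFrame bb + U (hcpShift + ξ)‖ ≤ 7 →
      bb ∈ R ∧ 6 ≤ ‖latPt U hexFrame bb + U (hcpShift + ξ)‖)
    {q f₀ : ℝ} (hq0 : U (ξ - ξ₀) = 0 → q ≤ 0)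
    (hext : (q / ‖U (ξ - ξ₀)‖ - f₀) * ‖U (ξ - ξ₀)‖ ≤
      ∑ bb ∈ B, (‖latPt U hexFrame bb + U (hcpShift + ξ)‖⁻¹ ^ 8 - ‖latPt U hexFrame bb + U (hcpShift + ξ)‖⁻¹ ^ 14) *
        ⟪latPt U hexFrame bb + U (hcpShift + ξ), U (ξ - ξ₀)⟫)
    (hslab : q ≤ ((6000 / 343 * (7 : ℝ)⁻¹ ^ 4 + 2880 / 49 * (7 : ℝ)⁻¹ ^ 5 + 10 / 7 * (7 : ℝ)⁻¹ ^ 6 + 2 * (7 : ℝ)⁻¹ ^ 7) + f₀ +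
        R.card * (6 : ℝ)⁻¹ ^ 7) * ‖U (ξ - ξ₀)‖ →
      (∀ (M : ℕ) (z : Fin M → E3) (cc : Fin M), Function.Injective z →
          Set.range z = {x : E3 | dist x (z cc) ≤ 133 / 10 ∧ ∃ a : Fin 3 → ℤ,
            x = z cc + latPt U hexFrame a ∨ x = z cc + latPt U hexFrame a + U (hcpShift + ξ)} →
          TightNearCap (9 / 5) (3 / 2) z cc ∨ ExemptNear (9 / 5) ExRec z cc ∨ BadNearCap (9 / 5) (3 / 2) z cc) ∨
        (μ : ℝ) / SC ≤ ∑ b ∈ (Fintype.piFinset fun _ : Fin 3 => Finset.Icc (-7 : ℤ) 7).filter (fun b => b ≠ 0), effPot w₄₅ ω₄ (3 / 400) ‖latPt U hexFrame b‖ +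
          ∑ b ∈ (Fintype.piFinset fun _ : Fin 3 => Finset.Icc (-7 : ℤ) 7), effPot w₄₅ ω₄ (3 / 400) ‖latPt U hexFrame b + U (hcpShift + ξ)‖) :
    (∀ (M : ℕ) (z : Fin M → E3) (cc : Fin M), Function.Injective z →
        Set.range z = {x : E3 | dist x (z cc) ≤ 133 / 10 ∧ ∃ a : Fin 3 → ℤ,
          x = z cc + latPt U hexFrame a ∨ x = z cc + latPt U hexFrame a + U (hcpShift + ξ)} →
        TightNearCap (9 / 5) (3 / 2) z cc ∨ ExemptNear (9 / 5) ExRec z cc ∨ BadNearCap (9 / 5) (3 / 2) z cc) ∨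
      (μ : ℝ) / SC ≤ ∑ b ∈ (Fintype.piFinset fun _ : Fin 3 => Finset.Icc (-7 : ℤ) 7).filter (fun b => b ≠ 0), effPot w₄₅ ω₄ (3 / 400) ‖latPt U hexFrame b‖ +
        ∑ b ∈ (Fintype.piFinset fun _ : Fin 3 => Finset.Icc (-7 : ℤ) 7), effPot w₄₅ ω₄ (3 / 400) ‖latPt U hexFrame b + U (hcpShift + ξ)‖ := by
  by_cases hq : q ≤ ((6000 / 343 * (7 : ℝ)⁻¹ ^ 4 + 2880 / 49 * (7 : ℝ)⁻¹ ^ 5 + 10 / 7 * (7 : ℝ)⁻¹ ^ 6 + 2 * (7 : ℝ)⁻¹ ^ 7) + f₀ +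
      R.card * (6 : ℝ)⁻¹ ^ 7) * ‖U (ξ - ξ₀)‖
  · exact hslab hq
  · refine Or.inl fun M z cc hz hrange => ?_
    rcases slab_or_exempt_of_targetForce hz hU hξ hrange B R hB hBin hR hq0 hext with h | h
    · exact absurd h hq
    · exact Or.inr (Or.inl h)

/-! ## §4. The Taylor-rate instances -/

/-- ★★★ **SLAB OR EXEMPT UNDER THE TAYLOR-RATE FLOOR**: with the `s`-dependent LJ force-Jacobian floor `(λ − a s − b s²)‖U(ξ − ξ₀)‖²` along the segment
and the reference bound `f₀`, for `q := (λ − a/2 − b/3)·‖U(ξ − ξ₀)‖²`: either `q ≤ (S₇♯ + f₀ + |R|·6⁻⁷)·‖U(ξ − ξ₀)‖` or `ExemptNear (9/5) ExRec z c`.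
[folklore chaining: §2 + §3] -/
theorem slab_or_exempt_of_taylorRing {M : ℕ} {z : Fin M → E3} {c : Fin M} (hz : Function.Injective z) {U : E3 →L[ℝ] E3} {ξ₀ ξ : E3}
    (hU : ‖U - 1‖ ≤ 1 / 4) (hξ₀ : ‖ξ₀‖ ≤ 1 / 4) (hξ : ‖ξ‖ ≤ 1 / 4)
    (hrange : Set.range z = {x : E3 | dist x (z c) ≤ 133 / 10 ∧ ∃ a : Fin 3 → ℤ,
      x = z c + latPt U hexFrame a ∨ x = z c + latPt U hexFrame a + U (hcpShift + ξ)})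
    (B R : Finset (Fin 3 → ℤ)) (hB : B ⊆ Fintype.piFinset fun _ : Fin 3 => Finset.Icc (-11 : ℤ) 11)
    (hBin : ∀ bb ∈ B, ‖latPt U hexFrame bb + U (hcpShift + ξ)‖ ≤ 7)
    (hR : ∀ bb ∈ (Fintype.piFinset fun _ : Fin 3 => Finset.Icc (-11 : ℤ) 11) \ B, ‖latPt U hexFrame bb + U (hcpShift + ξ)‖ ≤ 7 →
      bb ∈ R ∧ 6 ≤ ‖latPt U hexFrame bb + U (hcpShift + ξ)‖)
    {lam a b f₀ : ℝ}
    (hcurv : ∀ s ∈ Set.Ioo (0 : ℝ) 1, (lam - a * s - b * s ^ 2) * ‖U (ξ - ξ₀)‖ ^ 2 ≤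
      ∑ bb ∈ B, segGd (fun x : ℝ => x⁻¹ ^ 7 - x⁻¹ ^ 13) (latPt U hexFrame bb + U (hcpShift + ξ₀)) (U (ξ - ξ₀)) s)
    (hf₀ : |∑ bb ∈ B, (‖latPt U hexFrame bb + U (hcpShift + ξ₀)‖⁻¹ ^ 8 - ‖latPt U hexFrame bb + U (hcpShift + ξ₀)‖⁻¹ ^ 14) *
        ⟪latPt U hexFrame bb + U (hcpShift + ξ₀), U (ξ - ξ₀)⟫| ≤ f₀ * ‖U (ξ - ξ₀)‖) :
    (lam - a / 2 - b / 3) * ‖U (ξ - ξ₀)‖ ^ 2 ≤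
        ((6000 / 343 * (7 : ℝ)⁻¹ ^ 4 + 2880 / 49 * (7 : ℝ)⁻¹ ^ 5 + 10 / 7 * (7 : ℝ)⁻¹ ^ 6 + 2 * (7 : ℝ)⁻¹ ^ 7) + f₀ + R.card * (6 : ℝ)⁻¹ ^ 7) *
          ‖U (ξ - ξ₀)‖ ∨ ExemptNear (9 / 5) ExRec z c := by
  have hext := hcpForceLJ_exterior_taylor B hU hξ₀ hξ hcurv hf₀
  refine slab_or_exempt_of_targetForce hz hU hξ hrange B R hB hBin hR (q := (lam - a / 2 - b / 3) * ‖U (ξ - ξ₀)‖ ^ 2) ?_ ?_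
  · intro h0
    rw [h0, norm_zero]
    simp
  · by_cases hΔ0 : U (ξ - ξ₀) = 0
    · rw [hΔ0]
      simp
    · have hpos : 0 < ‖U (ξ - ξ₀)‖ := norm_pos_iff.2 hΔ0
      have h1 : (lam - a / 2 - b / 3) * ‖U (ξ - ξ₀)‖ ^ 2 / ‖U (ξ - ξ₀)‖ = (lam - a / 2 - b / 3) * ‖U (ξ - ξ₀)‖ := by
        field_simp
      rw [h1]
      exact hext

/-- ★★★ **THE `hver` CONCLUSION OF A SLAB LEAF WITH THE TAYLOR-RATE EXTERIOR** (the real-side target of the successor's kernel Boolean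
`curvLJ_floorMTaylor_of_check`): the `s`-dependent floor, the reference force bound and the in-slab coverage give the leaf conclusion for `(U, ξ)`. [folklore chaining] -/
theorem hver_of_slabParts_taylor {μ : ℤ} {U : E3 →L[ℝ] E3} {ξ₀ ξ : E3} (hU : ‖U - 1‖ ≤ 1 / 4) (hξ₀ : ‖ξ₀‖ ≤ 1 / 4) (hξ : ‖ξ‖ ≤ 1 / 4)
    (B R : Finset (Fin 3 → ℤ)) (hB : B ⊆ Fintype.piFinset fun _ : Fin 3 => Finset.Icc (-11 : ℤ) 11)
    (hBin : ∀ bb ∈ B, ‖latPt U hexFrame bb + U (hcpShift + ξ)‖ ≤ 7)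
    (hR : ∀ bb ∈ (Fintype.piFinset fun _ : Fin 3 => Finset.Icc (-11 : ℤ) 11) \ B, ‖latPt U hexFrame bb + U (hcpShift + ξ)‖ ≤ 7 →
      bb ∈ R ∧ 6 ≤ ‖latPt U hexFrame bb + U (hcpShift + ξ)‖)
    {lam a b f₀ : ℝ}
    (hcurv : ∀ s ∈ Set.Ioo (0 : ℝ) 1, (lam - a * s - b * s ^ 2) * ‖U (ξ - ξ₀)‖ ^ 2 ≤
      ∑ bb ∈ B, segGd (fun x : ℝ => x⁻¹ ^ 7 - x⁻¹ ^ 13) (latPt U hexFrame bb + U (hcpShift + ξ₀)) (U (ξ - ξ₀)) s)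
    (hf₀ : |∑ bb ∈ B, (‖latPt U hexFrame bb + U (hcpShift + ξ₀)‖⁻¹ ^ 8 - ‖latPt U hexFrame bb + U (hcpShift + ξ₀)‖⁻¹ ^ 14) *
        ⟪latPt U hexFrame bb + U (hcpShift + ξ₀), U (ξ - ξ₀)⟫| ≤ f₀ * ‖U (ξ - ξ₀)‖)
    (hslab : (lam - a / 2 - b / 3) * ‖U (ξ - ξ₀)‖ ^ 2 ≤ ((6000 / 343 * (7 : ℝ)⁻¹ ^ 4 + 2880 / 49 * (7 : ℝ)⁻¹ ^ 5 + 10 / 7 * (7 : ℝ)⁻¹ ^ 6 +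
        2 * (7 : ℝ)⁻¹ ^ 7) + f₀ + R.card * (6 : ℝ)⁻¹ ^ 7) * ‖U (ξ - ξ₀)‖ →
      (∀ (M : ℕ) (z : Fin M → E3) (cc : Fin M), Function.Injective z →
          Set.range z = {x : E3 | dist x (z cc) ≤ 133 / 10 ∧ ∃ a : Fin 3 → ℤ,
            x = z cc + latPt U hexFrame a ∨ x = z cc + latPt U hexFrame a + U (hcpShift + ξ)} →
          TightNearCap (9 / 5) (3 / 2) z cc ∨ ExemptNear (9 / 5) ExRec z cc ∨ BadNearCap (9 / 5) (3 / 2) z cc) ∨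
        (μ : ℝ) / SC ≤ ∑ b ∈ (Fintype.piFinset fun _ : Fin 3 => Finset.Icc (-7 : ℤ) 7).filter (fun b => b ≠ 0), effPot w₄₅ ω₄ (3 / 400) ‖latPt U hexFrame b‖ +
          ∑ b ∈ (Fintype.piFinset fun _ : Fin 3 => Finset.Icc (-7 : ℤ) 7), effPot w₄₅ ω₄ (3 / 400) ‖latPt U hexFrame b + U (hcpShift + ξ)‖) :
    (∀ (M : ℕ) (z : Fin M → E3) (cc : Fin M), Function.Injective z →
        Set.range z = {x : E3 | dist x (z cc) ≤ 133 / 10 ∧ ∃ a : Fin 3 → ℤ,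
          x = z cc + latPt U hexFrame a ∨ x = z cc + latPt U hexFrame a + U (hcpShift + ξ)} →
        TightNearCap (9 / 5) (3 / 2) z cc ∨ ExemptNear (9 / 5) ExRec z cc ∨ BadNearCap (9 / 5) (3 / 2) z cc) ∨
      (μ : ℝ) / SC ≤ ∑ b ∈ (Fintype.piFinset fun _ : Fin 3 => Finset.Icc (-7 : ℤ) 7).filter (fun b => b ≠ 0), effPot w₄₅ ω₄ (3 / 400) ‖latPt U hexFrame b‖ +
        ∑ b ∈ (Fintype.piFinset fun _ : Fin 3 => Finset.Icc (-7 : ℤ) 7), effPot w₄₅ ω₄ (3 / 400) ‖latPt U hexFrame b + U (hcpShift + ξ)‖ := by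
  by_cases hq : (lam - a / 2 - b / 3) * ‖U (ξ - ξ₀)‖ ^ 2 ≤ ((6000 / 343 * (7 : ℝ)⁻¹ ^ 4 + 2880 / 49 * (7 : ℝ)⁻¹ ^ 5 + 10 / 7 * (7 : ℝ)⁻¹ ^ 6 +
      2 * (7 : ℝ)⁻¹ ^ 7) + f₀ + R.card * (6 : ℝ)⁻¹ ^ 7) * ‖U (ξ - ξ₀)‖
  · exact hslab hq
  · refine Or.inl fun M z cc hz hrange => ?_
    rcases slab_or_exempt_of_taylorRing hz hU hξ₀ hξ hrange B R hB hBin hR hcurv hf₀ with h | h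
    · exact absurd h hq
    · exact Or.inr (Or.inl h)

end Summit.AtomisticToContinuum.Crystallization.Theorems.FrustratedLawDichotomyStrainedPatchHomExteriorTaylor

end
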